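import Summits.BirchSwinnertonDyer.BirchSwinnertonDyer.Theorems.GenusKolyvaginAtTwoOffCutResidualAtTwoRLw2PhantomExclusionWitness
import Summits.BirchSwinnertonDyer.BirchSwinnertonDyer.Theorems.CMKolyvaginAtInertTwoRationalDescentAtTwoTower
import HarnessLib

/-!
# Route `GenusKolyvaginAtTwo`, residual `OffCutResidualAtTwoR` (stmt-BirchSwinnertonDyer-31767), LINE 26 «lw2_phantom_exclusion»:
# THE ENGINE HYPOTHESIS `(NPh)` IS DECIDED BY `E` ALONE — on a Heegner frame with `2` split, `(NPh_M)` for every `M ≥ 1` ⟺ the level-2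
# Lawson–Wuthrich class of `E/ℚ` fails the Kummer condition at some prime `p ∣ 2N` OVER `ℚ`

Width seat `bsd-line-gk2-p4` g31 (cell `bsd-f1-sign2`), `--supports stmt-BirchSwinnertonDyer-31767 --as helper`.  THEOREMS ONLY (no
definition, no named fact, no `sorry`).  **BSD is NOT proved by this file; nothing is closed by it alone.**

WHAT.  `…Lw2PhantomExclusionWitness` (this seat, p781093) proved, on the route's frame, `(NPh_M)(W, K)` for all `M ≥ 1` ⟺ a level-2 witness place
`w₀ ∋ 2N` of `K` exists.  This file descends the criterion to `ℚ`: when every place of `K` over `2N` has degree one over `ℚ` — the frames of the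
`K`-kernel items (Heegner hypothesis for `N` AND `2` split in `K`, e.g. `K4Pos` / `K4Neg`), or any Heegner frame when `2 ∣ N` — the `K`-witness at
`w₀` is EQUIVALENT to the `ℚ`-witness at the prime `v₀ = w₀ ∩ ℤ`:
* `levelTwoWitness_rat_of_baseChange` — a `K`-witness at `w₀` gives a `ℚ`-witness at `w₀ ∩ ℤ` (no degree condition: `res_K` is injective, maps the
  classes dying on `Γ_{ℚ(E[4])}` to classes dying on `Γ_{K(E[4])}`, and the Selmer local condition is functorial under restriction,
  `KolyvaginRatDescentTwo.resTorsion_mem_selmerLocalKer_of_under`);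
* `finrank_adicCompletion_eq_one_of_mem_two_mul` — on a Heegner frame with `2` split every `w ∋ 2N` has `[K_w : ℚ_v] = 1`;
* ★ `nonPhantom_pow_iff_levelTwoWitness_rat` — **on such a frame, `(NPh_M)(W, K)` for every `M ≥ 1` ⟺ `∃ v ∋ 2N` (a prime `p ∣ 2N`) such that no
  non-zero class of `H¹(ℚ, E[2])` dying on `Γ_{ℚ(E[4])}` is Kummer at `ℚ_v`.**  The right-hand side does not mention `K`.
READING for the planners (no new claim about any curve): whether ANY `(NPh)`-fed engine (the cut, LINES 18/24/26) can run for `E` at ANY `2`-split Heegner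
frame is the `E`-intrinsic, per-curve decidable question «is `ξ_E = [−Δ·F′(e)]` locally a Kummer class at every `p ∣ 2N`?» (LINE 26 instrument LW2,
kit j339762, extended from `p ∣ N` to `p ∣ 2N`); by `…Lw2PhantomExclusionCut` every curve with an odd multiplicative prime passes.  BSD is NOT proved by
any of this.

References: [LawsonWuthrich2016] §3, §7.1, §8; [GrossLMS1991] §1, §9; [McCallumLMS1991] §4 Lemma 4.3; [SerreGaloisCohomology1997] I.§2.4, I.§2.6 (b);
[CasselsFrohlich1967] Ch. I §10 Prop. 1; [NeukirchANT1999] Ch. II Prop. (8.5).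
-/

set_option autoImplicit false
-- the Theorems namespace of this sub repeats the summit name by design (D-0017 nested layout)
set_option linter.dupNamespace false

noncomputable section

open scoped Classical NumberField

namespace Summit.BirchSwinnertonDyer.BirchSwinnertonDyer.Theorems.GenusExact.Lw2PhantomExclusion

open WeierstrassCurve NumberField Field IsDedekindDomain
open Literature.NumberTheory.EllipticCurves Literature.NumberTheory.GaloisRepresentations
open Summit.BirchSwinnertonDyer.BirchSwinnertonDyer.Theorems.KolyvaginLowerBoundAtTwo (torsionFixing_le_of_dvd)
open Literature.AnabelianGeometry.AbsoluteAnabelian.NeukirchUchidaProof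
  (ramificationIdx_ringOfIntegersRat_eq_int' inertiaDeg_ringOfIntegersRat_eq_int')

variable (W : WeierstrassCurve ℚ) [W.IsElliptic] {K : Type} [Field K] [NumberField K]

/-! ## §1 Descent of the witness `K → ℚ` -/

/-- **A `K`-witness at `w₀` is a `ℚ`-witness at `w₀ ∩ ℤ`** (frame: `ρ_{E,2^n}` onto over `ℚ`, `K` imaginary quadratic; no degree condition on `w₀`): a
non-zero `z ∈ H¹(ℚ, E[2])` dying on `Γ_{ℚ(E[4])}` restricts to a non-zero class dying on `Γ_{K(E[4])}` (`resTorsion_ne_zero_and_forall_torsionFixing_four`), and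
`z ∈ 𝓛_{w₀ ∩ ℤ}(E) ⟹ res_K z ∈ 𝓛_{w₀}(E_K)` (`KolyvaginRatDescentTwo.resTorsion_mem_selmerLocalKer_of_under`). [cite: SerreGaloisCohomology1997, I.§2.4 and II.§1.1]
[cite: McCallumLMS1991, §4 Lemma 4.3] -/
theorem levelTwoWitness_rat_of_baseChange
    (hρ : ∀ n : ℕ, 0 < n → W.HasSurjectiveModNGaloisRep ((2 : ℤ) ^ n)) (hK : IsImaginaryQuadratic K)
    (w₀ : HeightOneSpectrum (𝓞 K))
    (hwit : ∀ z : galH1Torsion (W.baseChange K) 2, z ≠ 0 →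
      (∀ ρ ∈ torsionFixing (W.baseChange K) 4, h1Eval (W.baseChange K) 2 z ρ = 0) →
        z ∉ selmerLocalKer (W.baseChange K) (w₀.adicCompletion K) 2) :
    ∀ z : galH1Torsion W 2, z ≠ 0 → (∀ ρ ∈ torsionFixing W 4, h1Eval W 2 z ρ = 0) →
      z ∉ selmerLocalKer W ((w₀.under (𝓞 ℚ)).adicCompletion ℚ) 2 := by
  intro z hz0 hz hzv
  obtain ⟨hr0, hr⟩ := resTorsion_ne_zero_and_forall_torsionFixing_four W hρ hK hz0 hz
  exact hwit _ hr0 hr (KolyvaginRatDescentTwo.resTorsion_mem_selmerLocalKer_of_under K W (2 : ℤ) w₀ hzv)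

/-! ## §2 On a Heegner frame with `2` split, every place over `2N` has degree one -/

omit [W.IsElliptic] in
/-- `[K_w : ℚ_v] = 1` from `e(w) = f(w) = 1` (the local degree is `e·f`, `GenusExact.PlusDescent.finrank_adicCompletionMap_eq_ramificationIdx_mul_inertiaDeg`).
[cite: NeukirchANT1999, Ch. II Prop. (8.5)] -/
theorem finrank_adicCompletion_eq_one_of_ramificationIdx_eq_one (v : HeightOneSpectrum (𝓞 ℚ)) (w : HeightOneSpectrum (𝓞 K))
    [w.asIdeal.LiesOver v.asIdeal] (he : w.asIdeal.ramificationIdx (𝓞 ℚ) = 1) (hf : w.asIdeal.inertiaDeg (𝓞 ℚ) = 1) :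
    letI : Algebra (v.adicCompletion ℚ) (w.adicCompletion K) := (adicCompletionMap (K := ℚ) K v w).toAlgebra
    Module.finrank (v.adicCompletion ℚ) (w.adicCompletion K) = 1 := by
  haveI : w.asIdeal.IsMaximal := w.isMaximal
  have h := GenusExact.PlusDescent.finrank_adicCompletionMap_eq_ramificationIdx_mul_inertiaDeg K v w
  rw [← ramificationIdx_ringOfIntegersRat_eq_int', ← inertiaDeg_ringOfIntegersRat_eq_int', he, hf, mul_one] at h
  exact h

omit [W.IsElliptic] in
/-- **On a Heegner frame with `2` split, every place `w ∋ 2N` of `K` has `[K_w : ℚ_v] = 1`** (`v = w ∩ ℤ`): `w` is prime, so `2 ∈ w` (then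
`e = f = 1` from `#{𝔭 ∣ 2} = 2`, `ramificationIdx_eq_one_and_inertiaDeg_eq_one_of_ncard_primesOver_eq_two`) or `N ∈ w` (Heegner hypothesis,
`ramificationIdx_eq_one_and_inertiaDeg_eq_one_of_natCast_mem_of_satisfiesHeegnerHypothesis`). [cite: GrossLMS1991, §1] [cite: CasselsFrohlich1967, Ch. I §10 Prop. 1] -/
theorem finrank_adicCompletion_eq_one_of_mem_two_mul (hK : IsImaginaryQuadratic K) {N : ℕ} (hN : N ≠ 0)
    (hH : SatisfiesHeegnerHypothesis N K) (h2 : ((Ideal.span {(2 : ℤ)}).primesOver (𝓞 K)).ncard = 2)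
    (w : HeightOneSpectrum (𝓞 K)) (h2Nw : ((2 * N : ℕ) : 𝓞 K) ∈ w.asIdeal) :
    letI : Algebra ((w.under (𝓞 ℚ)).adicCompletion ℚ) (w.adicCompletion K) :=
      (adicCompletionMap (K := ℚ) K (w.under (𝓞 ℚ)) w).toAlgebra
    Module.finrank ((w.under (𝓞 ℚ)).adicCompletion ℚ) (w.adicCompletion K) = 1 := by
  haveI : w.asIdeal.LiesOver (w.under (𝓞 ℚ)).asIdeal := ⟨rfl⟩
  haveI : Fact (Nat.Prime 2) := ⟨Nat.prime_two⟩
  rw [Nat.cast_mul] at h2Nw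
  rcases w.isPrime.mem_or_mem h2Nw with h2w | hNw
  · obtain ⟨he, hf⟩ := ramificationIdx_eq_one_and_inertiaDeg_eq_one_of_ncard_primesOver_eq_two 2 hK.1
      (by exact_mod_cast h2) w (by exact_mod_cast h2w)
    exact finrank_adicCompletion_eq_one_of_ramificationIdx_eq_one (K := K) _ w he hf
  · obtain ⟨he, hf⟩ := ramificationIdx_eq_one_and_inertiaDeg_eq_one_of_natCast_mem_of_satisfiesHeegnerHypothesis hK.1 hH hN w hNw
    exact finrank_adicCompletion_eq_one_of_ramificationIdx_eq_one (K := K) _ w he hf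

/-! ## §3 The `E`-intrinsic criterion -/

/-- ★ **`(NPh)` IS DECIDED OVER `ℚ`.**  Frame: `ρ_{E,2^n}` onto over `ℚ` for all `n`; `K` imaginary quadratic, `d_K` odd, `d_K·(−|Δ|)`, `d_K·(−2|Δ|)`
non-squares, Heegner hypothesis for `N ≠ 0` and `2` SPLIT in `K` (the frames of `K4Pos` / `K4Neg`).  Then `(NPh_M)(W, K)` holds for every `M ≥ 1` (every class of
`H¹(K, E[2^M])` dying on `Γ_{K(E[2^M])}` and Kummer at all places over `2N` is `0`) **iff** there is a place `v ∋ 2N` of `ℚ` at which no non-zero class of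
`H¹(ℚ, E[2])` dying on `Γ_{ℚ(E[4])}` is Kummer — a condition on `E` alone (the right-hand side does not mention `K`).  (⟹) `…Witness`
`nonPhantom_pow_iff_levelTwoWitness` gives a `K`-witness `w₀ ∋ 2N`, §1 descends it to `w₀ ∩ ℤ ∋ 2N`; (⟸) every `w ∣ v` has degree one (§2), so the
`ℚ`-witness lifts (`levelTwoWitness_baseChange_of_finrank_eq_one`) and `…KLW` concludes.  BSD is NOT proved by this.
[cite: LawsonWuthrich2016, §3, §7.1 and §8] [cite: GrossLMS1991, §9 Prop. 9.1] [cite: McCallumLMS1991, §4 Lemma 4.3] -/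
theorem nonPhantom_pow_iff_levelTwoWitness_rat
    (hρ : ∀ n : ℕ, 0 < n → W.HasSurjectiveModNGaloisRep ((2 : ℤ) ^ n)) (hK : IsImaginaryQuadratic K)
    (hodd : Odd (NumberField.discr K)) (hnsq₁ : ¬ IsSquare ((NumberField.discr K : ℚ) * -|W.Δ|))
    (hnsq₂ : ¬ IsSquare ((NumberField.discr K : ℚ) * (-(2 * |W.Δ|)))) {N : ℕ} (hN : N ≠ 0)
    (hH : SatisfiesHeegnerHypothesis N K) (h2 : ((Ideal.span {(2 : ℤ)}).primesOver (𝓞 K)).ncard = 2) :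
    (∀ (Mlev : ℕ), 1 ≤ Mlev → ∀ z : galH1Torsion (W.baseChange K) ((2 ^ Mlev : ℕ) : ℤ),
        (∀ ρ ∈ torsionFixing (W.baseChange K) ((2 ^ Mlev : ℕ) : ℤ), h1Eval (W.baseChange K) ((2 ^ Mlev : ℕ) : ℤ) z ρ = 0) →
        (∀ w : HeightOneSpectrum (𝓞 K), ((2 * N : ℕ) : 𝓞 K) ∈ w.asIdeal →
          z ∈ selmerLocalKer (W.baseChange K) (w.adicCompletion K) ((2 ^ Mlev : ℕ) : ℤ)) → z = 0) ↔
      ∃ v : HeightOneSpectrum (𝓞 ℚ), ((2 * N : ℕ) : 𝓞 ℚ) ∈ v.asIdeal ∧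
        ∀ z : galH1Torsion W 2, z ≠ 0 → (∀ ρ ∈ torsionFixing W 4, h1Eval W 2 z ρ = 0) →
          z ∉ selmerLocalKer W (v.adicCompletion ℚ) 2 := by
  rw [nonPhantom_pow_iff_levelTwoWitness W hρ hK hodd hnsq₁ hnsq₂ N]
  constructor
  · rintro ⟨w₀, h2Nw₀, hwit⟩
    refine ⟨w₀.under (𝓞 ℚ), ?_, levelTwoWitness_rat_of_baseChange W hρ hK w₀ hwit⟩
    have h : ((2 * N : ℕ) : 𝓞 K) = algebraMap (𝓞 ℚ) (𝓞 K) ((2 * N : ℕ) : 𝓞 ℚ) := by rw [map_natCast]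
    change ((2 * N : ℕ) : 𝓞 ℚ) ∈ w₀.asIdeal.under (𝓞 ℚ)
    rw [Ideal.under_def, Ideal.mem_comap, ← h]
    exact h2Nw₀
  · rintro ⟨v, h2Nv, hwit⟩
    have h2N : 2 * N ≠ 0 := by positivity
    obtain ⟨w₀, hw₀v, h2Nw₀⟩ := exists_place_liesOver_natCast_mem (K := K) h2N h2Nv
    haveI := hw₀v
    have hv : w₀.under (𝓞 ℚ) = v := HeightOneSpectrum.ext hw₀v.over.symm
    have h1 := finrank_adicCompletion_eq_one_of_mem_two_mul hK hN hH h2 w₀ h2Nw₀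
    refine ⟨w₀, h2Nw₀, ?_⟩
    subst hv
    exact levelTwoWitness_baseChange_of_finrank_eq_one W hρ hK hodd hnsq₁ hnsq₂ (w₀.under (𝓞 ℚ)) w₀ h1 hwit

end Summit.BirchSwinnertonDyer.BirchSwinnertonDyer.Theorems.GenusExact.Lw2PhantomExclusion

end
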